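import Literature.MathematicalPhysics.QuantumFieldTheory.Balaban1983to89.B5Projector144Torus

/-!
# `Balaban1983to89.B5Lambda0TwinBridge` — [Balaban1984PropagatorsI] Sect. C: the minimiser `λ₀` of (1.24) written as
# (1.26) p. 22 (`Δ⁻¹`-form) and as (1.43) p. 25 (`G′_k`-form) IS ONE VECTOR — `Δ⁻¹R₍₁.₃₈₎ = λ₀₍₁.₄₃₎ = Δ⁻¹R₍₁.₄₄₎` on all of
# `L²(T_η)`, for every admissible `a`; and on the typed torus r02's `B5Value126.lambda0` IS adv4's `B5Projector144.lambda0`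

statement-level skeleton of published theorems with citation tags; proofs where landed; nothing here is a claim
about the Yang–Mills mass gap

v1.1 (doc-only, r05 SECOND-READ-B5 pass 42 nit N-42-1): the locator of `eq_zero_of_q_of_lap` / `eq_of_q_of_lap` for «recall also that
the operator Δ is positive definite on N(Q′_k), thus invertible» is p. 25, the prose sentence AFTER the «∫dλ δ_R(λ)f(λ) = …» display
(text layer p0009 L17–18), not «ll. 3–4» (which hold «subspace ΔN(Q′_k) … Indeed RΔλ = Δλ …», the locator of `q_lapInv_R138`);
every declaration is byte-identical to v1.0 (p393594).

Mega-formalization `lit-balaban` (HOME `run/shared/lean/pub/lit-balaban/`), unit `lit-balaban-r20` gen 75 (B12 fold owner /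
DEFINITIONS steward; ruling G.5-1 «keep both, bridge»).  STEWARD BRIDGE for the register pair **H43** (DEFINITIONS v1.97 (ii)):
two definitions WITH BODIES (`DiT`, `CiT`: the real-field readings of r02's typed `Δ⁻¹` and `(Q′_kΔ⁻²Q′*_k)⁻¹`, in the style of
`B5Projector144Torus.QT` / `B5GaussSectC.DeltaT`), theorems otherwise; 0 named facts, 0 sorry.

THE TWINS.
* `B5Value126.lambda0 n M c b = Δ⁻¹b − Δ⁻¹Δ⁻¹Q′*_k ω₀`, `ω₀ = (Q′_kΔ⁻²Q′*_k)⁻¹Q′_kΔ⁻¹b` — the λ₀ of **(1.26)** p. 22 on r02's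
  typed complex torus (`LapSinv`, `QsOp`, `Minv`; `lambda0_eq_LapSinv`: `λ₀ = Δ⁻¹(I − PcT)b`), versus
* `B5Projector144.lambda0 q qs g c₂ = G′_k − G′_k²Q′_k*(Q′_kG′_k²Q′_k*)⁻¹Q′_kG′_k` — the λ₀ of **(1.43)** p. 25 at reader adv4's
  abstract level (real inner-product spaces `E`, `F`; `g` = `G′_k` = `(Δ + aQ′_k*Q′_k)⁻¹`, `c₂` = `(Q′_kG′_k²Q′_k*)⁻¹` bundled in
  `GreenData`), instantiated on the real torus `L2T n M` by `B5Projector144Torus` (`DeltaT`, `QT`, `QsT` / the printed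
  weighted adjoint `QsW`).
The tree compared the two PROJECTIONS R (`B5Projector144.R138_eq_R144_add_proj1`, `B5Projector144Torus.Rop_torus_eq_R144…`,
`B5PBridgeProjection.RT_eq_one_sub_green`) but had no statement at the level of λ₀.

CITATION HEADER.  [Balaban1984PropagatorsI] T. Bałaban, *Propagators and renormalization transformations for lattice gauge
theories. I*, Commun. Math. Phys. **95** (1984) 17–40 (held `paper:balaban1984-cmp95-propagators-rt-i`, text layer re-read
2026-08-25: p0006 = p. 22 L20–21, p0009 = p. 25 L25–27, p0010 = p. 26 L7–8).  p. 22: *«… and the infimum in (1.24) is acquired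
at the function λ₀ = Δ⁻¹∂*A − Δ⁻²Q′*_k(Q′_kΔ⁻²Q′*_k)⁻¹Q′_kΔ⁻¹∂*A.»* (the display preceding (1.26)).  p. 25: *«We repeat the
calculations done after the formula (1.24) with the operator Δ′_a instead of Δ and we get the following formulas for the
minimizing function λ₀,  λ₀ = G′_k∂*A − G′_k²Q′_k*(Q′_kG′_k²Q′_k*)⁻¹Q′_kG′_k∂*A, (1.43)  and for the projection operator R
R = I − G′_kQ′_k*(Q′_kG′_k²Q′_k*)⁻¹Q′_kG′_k. (1.44)»*.  p. 26 ll. 7–8: *«The operator R given by (1.44) is of course by definition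
independent of a and we can take arbitrary a in the representation»*.

WHAT IS PROVED.
* §1 (abstract, `B5Projector144`'s letters; dimension-free linear algebra over `LapData` / `AvgData` / the right-inverse clause
  `hci` of (Q′_kΔ⁻²Q′_k*)⁻¹ / `GreenData`): `eq_of_q_of_lap` (a vector of `N(Q′_k)` is determined by its `Δ`-image — the
  uniqueness half of «the minimizing function»); **`lambda0_indep`** (the λ₀ of (1.43) does not depend on `a`: the p. 26
  sentence, printed for R, holds for λ₀); `q_lapInv_R138`, `lap_lapInv_R138`; **`lapInv_R138_eq_lambda0`**:
  `Δ⁻¹(R₍₁.₃₈₎f) = λ₀₍₁.₄₃₎(f)` FOR EVERY `f ∈ E` (no orthogonality to the constants is needed: the constant component of `R₍₁.₃₈₎f`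
  is killed by `Δ⁻¹`), `lapInv_comp_R138_eq_lambda0` (as linear maps); **`lambda0_eq_lapInv_R144`**: `λ₀ = Δ⁻¹R₍₁.₄₄₎f`
  (needs no `ci`); `inner_one_lambda0` (`λ₀ ⊥ 1`).
* §2 (the typed torus, `c ≠ 0` real): `DiT` / `CiT` and their complex readings (`cplx_ofLp_DiT`, …); **`lapData_torus`**
  (`LapData oneT DeltaT DiT`: r02's `LapS_LapSinv_of_orth`, `LapSinv_LapS_of_orth`, `LapSinv_const`, `LapSinv_conjTranspose`),
  **`rightInv_torus`** (the `hci` clause: r02's `Mop_Minv_of_orth`); `cplx_ofLp_R138` (adv4's `R138` at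
  (`DiT`, `QT`, `QsT`, `CiT`) acts as r02's `1 − PcT`), `cplx_ofLp_lapInv_R138` (… and `Δ⁻¹R₍₁.₃₈₎` as r02's `lambda0`).
* §3 THE BRIDGE: **`cplx_lambda0_eq`** — for EVERY `GreenData (DeltaT n M c) (QT n M) (QsT n M) a g c₂` and every real field
  `x`: `B5Projector144.lambda0 (QT) (QsT) g c₂ x`, read as a complex vector, `= B5Value126.lambda0 n M c x`;
  `cplx_lambda0_eq_printedAdjoint` (the same with the printed weighted adjoint `QsW`); `lambda0_real_eq` (for real vectors
  `b`); `exists_greenData_lambda0_eq` (∃-form, every printed `a > 0`); **`PcT_cplx_eq_P144`** (on fields `⊥ 1` r02's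
  `PcT` = adv4's `P144`: the (1.26) residual is the (1.42)–(1.44) residual); `lambda0_eq_DiT_Rop` (`λ₀ = Δ⁻¹Rx` with R the
  orthogonal projection `B5GaussSectC.Rop` onto `ΔN(Q′_k)`); and hypothesis-free **`lambda0_eq_LapSinv_Rop`** /
  `LapS_lambda0_eq_Rop`: r02's λ₀ of (1.26) `= Δ⁻¹(Rx)` and `Δλ₀ = Rx` for EVERY real field `x`.

HONEST SCOPE.  (i) Bridge only: the existence of `G′_k`, `(Q′_kG′_k²Q′_k*)⁻¹` is `B5Projector144Torus.exists_all_torus`, the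
minimising property is `B5Projector144.inf_142` / `B5Infimum124`, none re-proved; that the abstract λ₀ of (1.43) lies in
`N(Q′_k)` with `Δλ₀ = R∂*A` is `B5GaussSectCR144.lambda0_mem_ker` / `Delta_lambda0` (abstract), used here through
`B5Projector144.q_lambda0` / `lap_lambda0`.  §2 (r02's `LapSinv` / `Minv` discharge `LapData` and the right-inverse clause;
`PcT` = `P144` on `1^⊥`) has a Summits-side twin in the substrate cell's `BalabanUV/T4Continuum/Support/SliceFlatGaugeProjection`
(`lapData_LinvT`, `hci_CinvT`, `PcT_apply_eq_P144`, for that cell's NE3 bookkeeping) which `Literature/` cannot import — §2 is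
the Literature-side home of those sentences, re-derived from the same Literature inputs; §1 and the λ₀-level §3 are new.  (ii) r02's `B5Value126.lambda0` allows any
`c : ℂ`; the bridge is stated for the lattice parameter `c` REAL and `≠ 0` (print: `η⁻¹ > 0`), where the real-field reading
makes sense.  (iii) The unweighted (transpose) adjoint `QsT` and the printed weighted adjoint `QsW = η^{-d}·QsT` give the same
λ₀ (`B5Projector144Torus.lambda0_rescale`); r02's `(QsOp)ᴴ` is the unweighted one.  Elementary linear algebra; tags
[cite: Balaban1984PropagatorsI, …] on the statements matching printed sentences, [folklore] on plumbing.
-/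

noncomputable section

open scoped InnerProductSpace Matrix ComplexConjugate

open Literature.MathematicalPhysics.QuantumFieldTheory.Balaban1983to89.B5Projector144
open Literature.MathematicalPhysics.QuantumFieldTheory.Balaban1983to89.B5Projector144Torus (L2B oneT oneB QT QsT
  QsW ofLp_QT ofLp_QsT QT_adj QT_oneT QT_perp oneB_ne_zero oneT_ne_zero inner_oneT inner_oneB cplx_injective cplx_one
  sum_cplx DeltaT_symm DeltaT_oneT greenData_rescale lambda0_rescale exists_all_torus Rop_torus_eq_R144_of_greenData)
open Literature.MathematicalPhysics.QuantumFieldTheory.Balaban1983to89.B5GaussSectC (L2T DeltaT NQ Rop ofLp_DeltaT)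
open Literature.MathematicalPhysics.QuantumFieldTheory.Balaban1983to89.B5Prop11Plancherel (Tor fine)
open Literature.MathematicalPhysics.QuantumFieldTheory.Balaban1983to89.B5Action121 (LapS)
open Literature.MathematicalPhysics.QuantumFieldTheory.Balaban1983to89.B5Block118 (QsOp)
open Literature.MathematicalPhysics.QuantumFieldTheory.Balaban1983to89.B5LaplaceInverse (LapSinv
  LapS_LapSinv_of_orth LapSinv_LapS_of_orth LapSinv_const LapSinv_conjTranspose)
open Literature.MathematicalPhysics.QuantumFieldTheory.Balaban1983to89.B5Substitution125 (Minv Mop Mop_mulVec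
  Mop_Minv_of_orth)
open Literature.MathematicalPhysics.QuantumFieldTheory.Balaban1983to89.B5RealFields (reM cplx IsReal cplx_apply
  cplx_eq_zero_iff reM_conjTranspose isReal_LapS isReal_LapSinv isReal_QsOp isReal_Minv)

namespace Literature.MathematicalPhysics.QuantumFieldTheory.Balaban1983to89.B5Lambda0TwinBridge

/-! ## §1  The abstract identity: `Δ⁻¹R₍₁.₃₈₎ = λ₀₍₁.₄₃₎ = Δ⁻¹R₍₁.₄₄₎`, and the `a`-independence of (1.43) -/

section Abstract

variable {E F : Type*} [NormedAddCommGroup E] [InnerProductSpace ℝ E] [NormedAddCommGroup F]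
  [InnerProductSpace ℝ F]
variable {one : E} {one' : F} {Δ Δi : E →ₗ[ℝ] E} {q : E →ₗ[ℝ] F} {qs : F →ₗ[ℝ] E} {ci : F →ₗ[ℝ] F}
  {a a' : ℝ} {g g' : E →ₗ[ℝ] E} {c₂ c₂' : F →ₗ[ℝ] F}

/-- A vector of `N(Q′_k)` killed by `Δ` vanishes (`G′_kΔλ = λ` on `N(Q′_k)`): «the operator Δ is positive definite on
N(Q′_k), thus invertible» in the form the bundles give it. [cite: Balaban1984PropagatorsI, p.25 (sentence after the δ_R display)] -/
theorem eq_zero_of_q_of_lap (hG : GreenData Δ q qs a g c₂) (l : E) (hq : q l = 0) (hΔ : Δ l = 0) : l = 0 := by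
  have h := hG.g_lap l hq
  rw [hΔ, map_zero] at h
  exact h.symm

/-- UNIQUENESS behind «the minimizing function λ₀»: two vectors of `N(Q′_k)` with the same `Δ`-image coincide.
[cite: Balaban1984PropagatorsI, p.25 (sentence after the δ_R display)] -/
theorem eq_of_q_of_lap (hG : GreenData Δ q qs a g c₂) (l l' : E) (hq : q l = 0) (hq' : q l' = 0)
    (h : Δ l = Δ l') : l = l' :=
  sub_eq_zero.mp (eq_zero_of_q_of_lap hG (l - l') (by rw [map_sub, hq, hq', sub_zero])
    (by rw [map_sub, h, sub_self]))

/-- **The λ₀ of (1.43) does not depend on `a`** (nor on the choice of the inverses): two systems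
`(a, G′_k, (Q′_kG′_k²Q′_k*)⁻¹)`, `(a′, G′, c′)` over the same `Δ`, `Q′_k`, `Q′_k*` give the same λ₀ — the p. 26 sentence
«by definition independent of a», printed for R (1.44) (`B5Projector144.R144_indep`), at the level of the minimiser.
[cite: Balaban1984PropagatorsI, (1.43) p.25 + p.26 ll.7-8] -/
theorem lambda0_indep (hG : GreenData Δ q qs a g c₂) (hG' : GreenData Δ q qs a' g' c₂')
    (hΔ : ∀ x y : E, inner ℝ (Δ x) y = inner ℝ x (Δ y))
    (hadj : ∀ (x : E) (φ : F), inner ℝ (q x) φ = inner ℝ x (qs φ)) :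
    lambda0 q qs g c₂ = lambda0 q qs g' c₂' := by
  refine LinearMap.ext fun f => ?_
  refine eq_of_q_of_lap hG _ _ (q_lambda0 hG f) (q_lambda0 hG' f) ?_
  rw [lap_lambda0 hG, lap_lambda0 hG', R144_indep hG hG' hΔ hadj]

/-- `Q′_kΔ⁻¹(R₍₁.₃₈₎f) = 0`: the vector `Δ⁻¹R₍₁.₃₈₎f` lies in `N(Q′_k)` — p. 25 «It is an orthogonal projection on the linear
subspace ΔN(Q′_k) … taking λ = Δ⁻¹ω we have ω = Δλ and Q′_kλ = 0» applied to `ω = Rf` (R idempotent).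
[cite: Balaban1984PropagatorsI, p.25 ll.2-5] -/
theorem q_lapInv_R138 (hΔ : LapData one Δ Δi) (hQ : AvgData one one' q qs) (hone : one ≠ 0)
    (hci : ∀ φ : F, inner ℝ one' φ = 0 → q (Δi (Δi (qs (ci φ)))) = φ) (f : E) :
    q (Δi (R138 Δi q qs ci f)) = 0 :=
  (R138_fix_iff hΔ hQ hone hci _).mp (R138_idem hΔ hQ hone hci f)

/-- `ΔΔ⁻¹(R₍₁.₃₈₎f) = R₍₁.₄₄₎f`: `Δ⁻¹` kills exactly the constant component by which the two printed R's (1.38) / (1.44)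
differ (`B5Projector144.R138_eq_R144_add_proj1`). [cite: Balaban1984PropagatorsI, (1.38) p.24 + (1.44) p.25] -/
theorem lap_lapInv_R138 (hΔ : LapData one Δ Δi) (hQ : AvgData one one' q qs) (hone : one ≠ 0)
    (hone' : one' ≠ 0) (hci : ∀ φ : F, inner ℝ one' φ = 0 → q (Δi (Δi (qs (ci φ)))) = φ)
    (hG : GreenData Δ q qs a g c₂) (f : E) :
    Δ (Δi (R138 Δi q qs ci f)) = R144 q qs g c₂ f := by
  rw [hΔ.lap_inv, proj1_R138 hΔ, R138_apply_eq hΔ hQ hone hone' hci hG, add_sub_cancel_right]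

/-- **(1.26) = (1.43) AT THE ABSTRACT LEVEL.** For every instance of the p. 22 / p. 25 hypotheses (`Δ⁻¹` with the
p. 22 convention, `Q′_k`, `Q′_k*`, a right inverse `(Q′_kΔ⁻²Q′_k*)⁻¹` on `1′^⊥`, and `G′_k`, `(Q′_kG′_k²Q′_k*)⁻¹` for some
`a`): `Δ⁻¹R₍₁.₃₈₎f = G′_kf − G′_k²Q′_k*(Q′_kG′_k²Q′_k*)⁻¹Q′_kG′_kf` for EVERY `f` — the λ₀ «acquired» in (1.24) written
as on p. 22 (`λ₀ = Δ⁻¹∂*A − Δ⁻²Q′*_k(Q′_kΔ⁻²Q′*_k)⁻¹Q′_kΔ⁻¹∂*A = Δ⁻¹(I − (I − R₍₁.₃₈₎))∂*A`) IS «the minimizing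
function λ₀» of (1.43). [cite: Balaban1984PropagatorsI, (1.26) p.22 + (1.43) p.25] -/
theorem lapInv_R138_eq_lambda0 (hΔ : LapData one Δ Δi) (hQ : AvgData one one' q qs) (hone : one ≠ 0)
    (hone' : one' ≠ 0) (hci : ∀ φ : F, inner ℝ one' φ = 0 → q (Δi (Δi (qs (ci φ)))) = φ)
    (hG : GreenData Δ q qs a g c₂) (f : E) :
    Δi (R138 Δi q qs ci f) = lambda0 q qs g c₂ f :=
  eq_of_q_of_lap hG _ _ (q_lapInv_R138 hΔ hQ hone hci f) (q_lambda0 hG f)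
    (by rw [lap_lapInv_R138 hΔ hQ hone hone' hci hG, lap_lambda0 hG])

/-- The same as an identity of linear maps: `Δ⁻¹ ∘ R₍₁.₃₈₎ = λ₀₍₁.₄₃₎`. [cite: Balaban1984PropagatorsI, (1.26) p.22 + (1.43) p.25] -/
theorem lapInv_comp_R138_eq_lambda0 (hΔ : LapData one Δ Δi) (hQ : AvgData one one' q qs) (hone : one ≠ 0)
    (hone' : one' ≠ 0) (hci : ∀ φ : F, inner ℝ one' φ = 0 → q (Δi (Δi (qs (ci φ)))) = φ)
    (hG : GreenData Δ q qs a g c₂) :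
    Δi ∘ₗ R138 Δi q qs ci = lambda0 q qs g c₂ :=
  LinearMap.ext fun f => lapInv_R138_eq_lambda0 hΔ hQ hone hone' hci hG f

/-- **`λ₀ = Δ⁻¹R₍₁.₄₄₎f`**: the minimiser (1.43) is `Δ⁻¹` of the orthogonal projection `R₍₁.₄₄₎f ∈ ΔN(Q′_k)` of its
argument (needs only `Δ⁻¹` with the p. 22 convention; no `(Q′_kΔ⁻²Q′_k*)⁻¹`). [cite: Balaban1984PropagatorsI, (1.43)-(1.44) p.25] -/
theorem lambda0_eq_lapInv_R144 (hΔ : LapData one Δ Δi) (hQ : AvgData one one' q qs) (hone : one ≠ 0)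
    (hone' : one' ≠ 0) (hG : GreenData Δ q qs a g c₂) (f : E) :
    lambda0 q qs g c₂ f = Δi (R144 q qs g c₂ f) := by
  obtain ⟨l, hl, hlf⟩ := (R144_fix_iff_exists hG _).mp (R144_idem hG f)
  have h1 : Δi (R144 q qs g c₂ f) = l := by
    rw [hlf, hΔ.inv_lap, proj1_eq_zero_of_inner _ _ (hQ.inner_one_of_ker hone hone' l hl), sub_zero]
  refine eq_of_q_of_lap hG _ _ (q_lambda0 hG f) (by rw [h1]; exact hl) ?_
  rw [lap_lambda0 hG, h1, ← hlf]

/-- … hence `λ₀ ⊥ 1` (print, p. 22: «We assume that λ is orthogonal» — automatic for the minimiser).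
[cite: Balaban1984PropagatorsI, p.22] -/
theorem inner_one_lambda0 (hQ : AvgData one one' q qs) (hone : one ≠ 0) (hone' : one' ≠ 0)
    (hG : GreenData Δ q qs a g c₂) (f : E) :
    inner ℝ one (lambda0 q qs g c₂ f) = 0 :=
  hQ.inner_one_of_ker hone hone' _ (q_lambda0 hG f)

end Abstract

/-! ## §2  The typed torus: r02's `Δ⁻¹` and `(Q′_kΔ⁻²Q′*_k)⁻¹` read on real fields discharge adv4's bundles -/

section Torus

variable {d : ℕ} (n : ℕ) [NeZero n] (M : Fin d → ℕ) [hM : ∀ μ, NeZero (M μ)]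

/-- `Δ⁻¹` of p. 22 on REAL fields: the real matrix re∘`LapSinv (fine n M) c` (r02's typed `Δ⁻¹`: inverse on `1^⊥`,
`0` on constants) acting on `L²(T_η)`. [cite: Balaban1984PropagatorsI, p.22] -/
def DiT (c : ℝ) : L2T n M →ₗ[ℝ] L2T n M :=
  Matrix.toEuclideanLin (reM (LapSinv (fine n M) (c : ℂ)))

/-- `(Q′_kΔ⁻²Q′*_k)⁻¹` of p. 22 on REAL fields: the real matrix re∘`B5Substitution125.Minv n M c` (r02's typed inverse
on the complement of the constants of the unit lattice). [cite: Balaban1984PropagatorsI, p.22] -/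
def CiT (c : ℝ) : L2B M →ₗ[ℝ] L2B M :=
  Matrix.toEuclideanLin (reM (Minv n M (c : ℂ)))

/-- Unfolding of `DiT`: it acts as the real matrix re∘`Δ⁻¹`. [cite: Balaban1984PropagatorsI, p.22] -/
theorem ofLp_DiT (c : ℝ) (x : L2T n M) :
    WithLp.ofLp (DiT n M c x) = reM (LapSinv (fine n M) (c : ℂ)) *ᵥ WithLp.ofLp x := rfl

/-- Unfolding of `CiT`: it acts as the real matrix re∘`(Q′_kΔ⁻²Q′*_k)⁻¹`. [cite: Balaban1984PropagatorsI, p.22] -/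
theorem ofLp_CiT (c : ℝ) (φ : L2B M) :
    WithLp.ofLp (CiT n M c φ) = reM (Minv n M (c : ℂ)) *ᵥ WithLp.ofLp φ := rfl

omit [NeZero n] hM in
/-- A real lattice parameter is self-conjugate. [folklore] -/
private theorem conj_coe (c : ℝ) : conj (c : ℂ) = c := Complex.conj_ofReal c

omit [NeZero n] hM in
/-- The complexification is compatible with subtraction. [folklore] -/
private theorem cplx_sub {m : Type*} (u v : m → ℝ) : cplx (u - v) = cplx u - cplx v := by
  funext i; simp [cplx]

/-- `DiT` read on complex vectors IS r02's typed `Δ⁻¹ = LapSinv` («by Δ⁻¹ we denote its inverse on this subspace … We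
extend it to the whole space by linearity»). [cite: Balaban1984PropagatorsI, p.22] -/
theorem cplx_ofLp_DiT (c : ℝ) (x : L2T n M) :
    cplx (WithLp.ofLp (DiT n M c x)) = LapSinv (fine n M) (c : ℂ) *ᵥ cplx (WithLp.ofLp x) := by
  rw [ofLp_DiT, (isReal_LapSinv (fine n M) (conj_coe c)).cplx_mulVec]

/-- `CiT` read on complex vectors IS r02's typed `(Q′_kΔ⁻²Q′*_k)⁻¹ = Minv` («Q′_kΔ⁻²Q′*_k is positive also on the
corresponding subspace on the unit lattice»). [cite: Balaban1984PropagatorsI, p.22] -/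
theorem cplx_ofLp_CiT (c : ℝ) (φ : L2B M) :
    cplx (WithLp.ofLp (CiT n M c φ)) = Minv n M (c : ℂ) *ᵥ cplx (WithLp.ofLp φ) := by
  rw [ofLp_CiT, (isReal_Minv n M (conj_coe c)).cplx_mulVec]

/-- `DeltaT` read on complex vectors IS the typed torus Laplacian `Δ = LapS` of (1.21).
[cite: Balaban1984PropagatorsI, (1.21) p.21 + p.22] -/
theorem cplx_ofLp_DeltaT (c : ℝ) (x : L2T n M) :
    cplx (WithLp.ofLp (DeltaT n M c x)) = LapS (fine n M) (c : ℂ) *ᵥ cplx (WithLp.ofLp x) := by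
  rw [ofLp_DeltaT, (isReal_LapS (fine n M) (conj_coe c)).cplx_mulVec]

/-- `QT` read on complex vectors IS the typed block average `Q′_k = QsOp` of (1.20). [cite: Balaban1984PropagatorsI, (1.20) p.20] -/
theorem cplx_ofLp_QT (x : L2T n M) :
    cplx (WithLp.ofLp (QT n M x)) = QsOp n M *ᵥ cplx (WithLp.ofLp x) := by
  rw [ofLp_QT, (isReal_QsOp n M).cplx_mulVec]

omit [NeZero n] in
/-- `QsT` read on complex vectors IS r02's (unweighted) adjoint `(QsOp)ᴴ` of the block average («This implies the
corresponding property for Q′_k*»). [cite: Balaban1984PropagatorsI, (1.20) p.20 + p.22] -/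
theorem cplx_ofLp_QsT (φ : L2B M) :
    cplx (WithLp.ofLp (QsT n M φ)) = (QsOp n M)ᴴ *ᵥ cplx (WithLp.ofLp φ) := by
  rw [ofLp_QsT, ← reM_conjTranspose, (isReal_QsOp n M).conjTranspose.cplx_mulVec]

/-- `Σ_x` of a complexified field is `⟨1, ·⟩`. [folklore] -/
private theorem sum_cplx_ofLp (x : L2T n M) : ∑ i, cplx (WithLp.ofLp x) i = ((inner ℝ (oneT n M) x : ℝ) : ℂ) := by
  rw [sum_cplx, inner_oneT]

omit [NeZero n] in
/-- `Σ_y` of a complexified unit-lattice field is `⟨1′, ·⟩`. [folklore] -/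
private theorem sum_cplx_ofLp' (φ : L2B M) : ∑ y, cplx (WithLp.ofLp φ) y = ((inner ℝ (oneB M) φ : ℝ) : ℂ) := by
  rw [sum_cplx, inner_oneB]

/-- «putting its value on constant functions equal to 0»: `Δ⁻¹1 = 0`. [cite: Balaban1984PropagatorsI, p.22] -/
theorem DiT_oneT (c : ℝ) : DiT n M c (oneT n M) = 0 := by
  apply (WithLp.ofLp_eq_zero 2).mp
  apply (cplx_eq_zero_iff _).mp
  rw [cplx_ofLp_DiT]
  have h1 : cplx (WithLp.ofLp (oneT n M)) = fun _ => (1 : ℂ) := by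
    rw [oneT, WithLp.ofLp_toLp, cplx_one]
  rw [h1]
  exact LapSinv_const (fine n M) (c : ℂ) 1

/-- `Δ⁻¹` kills the constant component `π₁x` («putting its value on constant functions equal to 0»).
[cite: Balaban1984PropagatorsI, p.22] -/
theorem DiT_proj1 (c : ℝ) (x : L2T n M) : DiT n M c (proj1 (oneT n M) x) = 0 := by
  rw [proj1_apply, map_smul, DiT_oneT, smul_zero]

/-- `Δ` kills the constant component `π₁x` («Constant functions form the eigenspace corresponding to the eigenvalue 0»).
[cite: Balaban1984PropagatorsI, p.22] -/
theorem DeltaT_proj1 (c : ℝ) (x : L2T n M) : DeltaT n M c (proj1 (oneT n M) x) = 0 := by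
  rw [proj1_apply, map_smul, DeltaT_oneT, smul_zero]

/-- «by Δ⁻¹ we denote its inverse on this subspace»: `ΔΔ⁻¹v = v` for `v ⊥ 1` (`c ≠ 0`).
[cite: Balaban1984PropagatorsI, p.22] -/
theorem DeltaT_DiT_of_orth {c : ℝ} (hc : c ≠ 0) (v : L2T n M) (hv : inner ℝ (oneT n M) v = 0) :
    DeltaT n M c (DiT n M c v) = v := by
  have hcC : (c : ℂ) ≠ 0 := by exact_mod_cast hc
  apply WithLp.ofLp_injective 2
  apply cplx_injective
  rw [cplx_ofLp_DeltaT, cplx_ofLp_DiT]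
  exact LapS_LapSinv_of_orth (fine n M) hcC _ (by rw [sum_cplx_ofLp, hv, Complex.ofReal_zero])

/-- … and `Δ⁻¹Δv = v` for `v ⊥ 1` (`c ≠ 0`). [cite: Balaban1984PropagatorsI, p.22] -/
theorem DiT_DeltaT_of_orth {c : ℝ} (hc : c ≠ 0) (v : L2T n M) (hv : inner ℝ (oneT n M) v = 0) :
    DiT n M c (DeltaT n M c v) = v := by
  have hcC : (c : ℂ) ≠ 0 := by exact_mod_cast hc
  apply WithLp.ofLp_injective 2
  apply cplx_injective
  rw [cplx_ofLp_DiT, cplx_ofLp_DeltaT]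
  exact LapSinv_LapS_of_orth (fine n M) hcC _ (by rw [sum_cplx_ofLp, hv, Complex.ofReal_zero])

/-- `ΔΔ⁻¹ = I − π₁` on all of `L²(T_η)` (`c ≠ 0`). [cite: Balaban1984PropagatorsI, p.22] -/
theorem DeltaT_DiT {c : ℝ} (hc : c ≠ 0) (x : L2T n M) :
    DeltaT n M c (DiT n M c x) = x - proj1 (oneT n M) x := by
  have hsplit : x = (x - proj1 (oneT n M) x) + proj1 (oneT n M) x := (sub_add_cancel _ _).symm
  conv_lhs => rw [hsplit]
  rw [map_add, map_add, DiT_proj1, map_zero, add_zero]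
  exact DeltaT_DiT_of_orth n M hc _ (inner_one_sub_proj1 (oneT_ne_zero n M) x)

/-- `Δ⁻¹Δ = I − π₁` on all of `L²(T_η)` (`c ≠ 0`). [cite: Balaban1984PropagatorsI, p.22] -/
theorem DiT_DeltaT {c : ℝ} (hc : c ≠ 0) (x : L2T n M) :
    DiT n M c (DeltaT n M c x) = x - proj1 (oneT n M) x := by
  have hsplit : x = (x - proj1 (oneT n M) x) + proj1 (oneT n M) x := (sub_add_cancel _ _).symm
  conv_lhs => rw [hsplit]
  rw [map_add, map_add, DeltaT_proj1, map_zero, add_zero]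
  exact DiT_DeltaT_of_orth n M hc _ (inner_one_sub_proj1 (oneT_ne_zero n M) x)

/-- re∘`Δ⁻¹` is a real symmetric matrix: the inverse on `1^⊥` of the «symmetric, non-negative operator» Δ, extended by
`0`, is symmetric (`LapSinv` is Hermitian). [cite: Balaban1984PropagatorsI, p.22] -/
theorem isHermitian_reM_LapSinv (c : ℝ) : (reM (LapSinv (fine n M) (c : ℂ))).IsHermitian := by
  rw [Matrix.IsHermitian, Matrix.conjTranspose_eq_transpose_of_trivial,
    B5RealFields.reM_transpose_of_isHermitian (LapSinv_conjTranspose (fine n M) (c : ℂ))]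

/-- `Δ⁻¹` is symmetric on `L²(T_η)` (Δ «is a symmetric … operator», p. 22, and so is its inverse on `1^⊥` extended by `0`).
[cite: Balaban1984PropagatorsI, p.22] -/
theorem DiT_symm (c : ℝ) (x y : L2T n M) : inner ℝ (DiT n M c x) y = inner ℝ x (DiT n M c y) :=
  (Matrix.isSymmetric_toEuclideanLin_iff.mpr (isHermitian_reM_LapSinv n M c)) x y

/-- **r02's `Δ⁻¹` DISCHARGES adv4's `LapData`** on the typed torus (`c ≠ 0`): Δ symmetric, `Δ1 = 0`, `ΔΔ⁻¹ = Δ⁻¹Δ = I − π₁`,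
`Δ⁻¹1 = 0` — the p. 22 paragraph «Now we use spectral properties of the Laplace operator Δ on the torus T_η …» for the
typed objects, with the SPECIFIC `Δ⁻¹ = B5LaplaceInverse.LapSinv` (not an abstract existence as in
`B5Projector144Torus.exists_all_torus`). [cite: Balaban1984PropagatorsI, p.22] -/
theorem lapData_torus {c : ℝ} (hc : c ≠ 0) : LapData (oneT n M) (DeltaT n M c) (DiT n M c) where
  symm := DeltaT_symm n M c
  map_one := DeltaT_oneT n M c
  lap_inv := DeltaT_DiT n M hc
  inv_lap := DiT_DeltaT n M hc
  inv_one := DiT_oneT n M c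

/-- **r02's `(Q′_kΔ⁻²Q′*_k)⁻¹` DISCHARGES adv4's right-inverse clause** (`c ≠ 0`): on `1′^⊥`,
`Q′_kΔ⁻¹Δ⁻¹Q′_k*·(Q′_kΔ⁻²Q′_k*)⁻¹ = I` — «Q′_kΔ⁻²Q′_k* is positive also on the corresponding subspace on the unit lattice»
(`B5Substitution125.Mop_Minv_of_orth`). [cite: Balaban1984PropagatorsI, p.22] -/
theorem rightInv_torus {c : ℝ} (hc : c ≠ 0) (φ : L2B M) (hφ : inner ℝ (oneB M) φ = 0) :
    QT n M (DiT n M c (DiT n M c (QsT n M (CiT n M c φ)))) = φ := by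
  have hcC : (c : ℂ) ≠ 0 := by exact_mod_cast hc
  apply WithLp.ofLp_injective 2
  apply cplx_injective
  rw [cplx_ofLp_QT, cplx_ofLp_DiT, cplx_ofLp_DiT, cplx_ofLp_QsT, cplx_ofLp_CiT, ← Mop_mulVec]
  exact Mop_Minv_of_orth n M (c : ℂ) hcC _ (by rw [sum_cplx_ofLp', hφ, Complex.ofReal_zero])

/-- adv4's `I − R₍₁.₃₈₎` at (`DiT`, `QT`, `QsT`, `CiT`) acts on complex vectors as r02's `PcT` (the typed
`Δ⁻¹Q′*_k(Q′_kΔ⁻²Q′*_k)⁻¹Q′_kΔ⁻¹`). [cite: Balaban1984PropagatorsI, (1.26) p.22 + (1.38) p.24] -/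
theorem cplx_ofLp_P138 (c : ℝ) (x : L2T n M) :
    cplx (WithLp.ofLp (P138 (DiT n M c) (QT n M) (QsT n M) (CiT n M c) x)) =
      B5Value126.PcT n M (c : ℂ) *ᵥ cplx (WithLp.ofLp x) := by
  rw [P138_apply, cplx_ofLp_DiT, cplx_ofLp_QsT, cplx_ofLp_CiT, cplx_ofLp_QT, cplx_ofLp_DiT,
    B5Value126.PcT_mulVec]

/-- adv4's `R₍₁.₃₈₎` at (`DiT`, `QT`, `QsT`, `CiT`) acts on complex vectors as r02's `1 − PcT`.
[cite: Balaban1984PropagatorsI, (1.38) p.24] -/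
theorem cplx_ofLp_R138 (c : ℝ) (x : L2T n M) :
    cplx (WithLp.ofLp (R138 (DiT n M c) (QT n M) (QsT n M) (CiT n M c) x)) =
      (1 - B5Value126.PcT n M (c : ℂ)) *ᵥ cplx (WithLp.ofLp x) := by
  rw [R138_apply, WithLp.ofLp_sub, cplx_sub, cplx_ofLp_P138, Matrix.sub_mulVec, Matrix.one_mulVec]

/-- `Δ⁻¹R₍₁.₃₈₎` at (`DiT`, `QT`, `QsT`, `CiT`) acts on complex vectors as r02's `B5Value126.lambda0` — LITERALLY the
p. 22 λ₀ (`lambda0_eq_LapSinv`: `λ₀ = Δ⁻¹(I − PcT)b`). [cite: Balaban1984PropagatorsI, (1.26) p.22] -/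
theorem cplx_ofLp_lapInv_R138 (c : ℝ) (x : L2T n M) :
    cplx (WithLp.ofLp (DiT n M c (R138 (DiT n M c) (QT n M) (QsT n M) (CiT n M c) x))) =
      B5Value126.lambda0 n M (c : ℂ) (cplx (WithLp.ofLp x)) := by
  rw [cplx_ofLp_DiT, cplx_ofLp_R138, B5Value126.lambda0_eq_LapSinv]

/-! ## §3  THE BRIDGE: r02's λ₀ of (1.26) IS adv4's λ₀ of (1.43) on the typed torus -/

/-- **H43, THE λ₀ TWIN BRIDGE.** For the lattice parameter `c ≠ 0`, EVERY `a` and EVERY `G′_k = (Δ + aQ′_k*Q′_k)⁻¹`,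
`(Q′_kG′_k²Q′_k*)⁻¹` on the typed torus (`GreenData`), and every real field `x` on `T_η`: adv4's abstract minimiser
(1.43) `G′_kx − G′_k²Q′_k*(Q′_kG′_k²Q′_k*)⁻¹Q′_kG′_kx`, read as a complex vector, IS r02's typed (1.26)
`Δ⁻¹x − Δ⁻²Q′*_k(Q′_kΔ⁻²Q′*_k)⁻¹Q′_kΔ⁻¹x` — «we get the following formulas for the minimizing function λ₀ (1.43)» (the
SAME λ₀ as on p. 22). [cite: Balaban1984PropagatorsI, (1.26) p.22 + (1.43) p.25] -/
theorem cplx_lambda0_eq {c : ℝ} (hc : c ≠ 0) {a : ℝ} {g : L2T n M →ₗ[ℝ] L2T n M} {c₂ : L2B M →ₗ[ℝ] L2B M}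
    (hG : GreenData (DeltaT n M c) (QT n M) (QsT n M) a g c₂) (x : L2T n M) :
    cplx (WithLp.ofLp (lambda0 (QT n M) (QsT n M) g c₂ x)) =
      B5Value126.lambda0 n M (c : ℂ) (cplx (WithLp.ofLp x)) := by
  rw [← lapInv_R138_eq_lambda0 (lapData_torus n M hc) ⟨QT_adj n M, QT_oneT n M, QT_perp n M⟩ (oneT_ne_zero n M) (oneB_ne_zero M)
    (rightInv_torus n M hc) hG x, cplx_ofLp_lapInv_R138]

/-- The two «I − R»'s agree where R is used: on real fields `x ⊥ 1` (every `∂*A`), r02's typed `PcT`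
(`Δ⁻¹Q′*_k(Q′_kΔ⁻²Q′*_k)⁻¹Q′_kΔ⁻¹`, the (1.26)/(1.38) form) acts as adv4's `P144` (`G′_kQ′_k*(Q′_kG′_k²Q′_k*)⁻¹Q′_kG′_k`, the
(1.44) form) — so r02's residual `∂*A − Δλ₀ = PcT ∂*A` (`B5Value126.residual_lambda0`) IS adv4's `∂*A − Δ′_aλ₀ = P₍₁.₄₄₎∂*A`
(`B5Projector144.residual_143`), and the value (1.26) is the value of (1.42) at the minimum. (`B5Projector144.R138_eq_R144_of_orth`
at the typed instance; the substrate cell's Summits-side `SliceFlatGaugeProjection.PcT_apply_eq_P144` is the same sentence in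
real coordinates, not importable here.) [cite: Balaban1984PropagatorsI, (1.26) p.22 + (1.44) p.25] -/
theorem PcT_cplx_eq_P144 {c : ℝ} (hc : c ≠ 0) {a : ℝ} {g : L2T n M →ₗ[ℝ] L2T n M} {c₂ : L2B M →ₗ[ℝ] L2B M}
    (hG : GreenData (DeltaT n M c) (QT n M) (QsT n M) a g c₂) (x : L2T n M) (hx : inner ℝ (oneT n M) x = 0) :
    B5Value126.PcT n M (c : ℂ) *ᵥ cplx (WithLp.ofLp x) = cplx (WithLp.ofLp (P144 (QT n M) (QsT n M) g c₂ x)) := by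
  have h := R138_eq_R144_of_orth (lapData_torus n M hc) ⟨QT_adj n M, QT_oneT n M, QT_perp n M⟩ (oneT_ne_zero n M) (oneB_ne_zero M)
    (rightInv_torus n M hc) hG x hx
  rw [R138_apply, R144_apply] at h
  rw [← cplx_ofLp_P138, sub_right_injective h]

/-- The same for REAL VECTORS `b : T_η → ℝ` (e.g. a real `∂*A`): r02's `λ₀(b)` is the complexification of adv4's `λ₀(b)`.
[cite: Balaban1984PropagatorsI, (1.26) p.22 + (1.43) p.25] -/
theorem lambda0_real_eq {c : ℝ} (hc : c ≠ 0) {a : ℝ} {g : L2T n M →ₗ[ℝ] L2T n M} {c₂ : L2B M →ₗ[ℝ] L2B M}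
    (hG : GreenData (DeltaT n M c) (QT n M) (QsT n M) a g c₂) (b : Tor (fine n M) → ℝ) :
    B5Value126.lambda0 n M (c : ℂ) (cplx b) =
      cplx (WithLp.ofLp (lambda0 (QT n M) (QsT n M) g c₂ (WithLp.toLp 2 b))) := by
  rw [cplx_lambda0_eq n M hc hG, WithLp.ofLp_toLp]

/-- The bridge with the PRINTED weighted adjoint `Q′_k* = QsW` (= `η^{-d}·QsT`): the λ₀ of (1.43) written with the printed
adjoint (and `G′_k`, `(Q′_kG′_k²Q′_k*)⁻¹` for it) is again r02's (1.26) λ₀. [cite: Balaban1984PropagatorsI, (1.20) p.20 + (1.43) p.25] -/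
theorem cplx_lambda0_eq_printedAdjoint {c : ℝ} (hc : c ≠ 0) {a : ℝ} {g : L2T n M →ₗ[ℝ] L2T n M}
    {c₂ : L2B M →ₗ[ℝ] L2B M} (hG : GreenData (DeltaT n M c) (QT n M) (QsW n M) a g c₂) (x : L2T n M) :
    cplx (WithLp.ofLp (lambda0 (QT n M) (QsW n M) g c₂ x)) =
      B5Value126.lambda0 n M (c : ℂ) (cplx (WithLp.ofLp x)) := by
  have hG' : GreenData (DeltaT n M c) (QT n M) (QsT n M) (((n : ℝ) ^ d) * a) g (((n : ℝ) ^ d) • c₂) :=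
    greenData_rescale hG
  rw [QsW, lambda0_rescale]
  exact cplx_lambda0_eq n M hc hG' x

/-- ∃-form: for `c ≠ 0` and every printed `a > 0` the inverses `G′_k`, `(Q′_kG′_k²Q′_k*)⁻¹` EXIST on the typed torus
(`B5Projector144Torus.exists_all_torus`) and the λ₀ of (1.43) built from them is r02's λ₀ of (1.26).
[cite: Balaban1984PropagatorsI, (1.26) p.22 + (1.43) p.25] -/
theorem exists_greenData_lambda0_eq {c : ℝ} (hc : c ≠ 0) {a : ℝ} (ha : 0 < a) :
    ∃ (g : L2T n M →ₗ[ℝ] L2T n M) (c₂ : L2B M →ₗ[ℝ] L2B M),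
      GreenData (DeltaT n M c) (QT n M) (QsT n M) a g c₂ ∧
      ∀ x : L2T n M, cplx (WithLp.ofLp (lambda0 (QT n M) (QsT n M) g c₂ x)) =
        B5Value126.lambda0 n M (c : ℂ) (cplx (WithLp.ofLp x)) := by
  obtain ⟨_, g, c₂, _, -, -, hG, -, -, -⟩ := exists_all_torus n M hc ha
  exact ⟨g, c₂, hG, fun x => cplx_lambda0_eq n M hc hG x⟩

/-- On the typed torus the λ₀ of (1.43) is `Δ⁻¹` of THE orthogonal projection onto `ΔN(Q′_k)` (`B5GaussSectC.Rop`, the R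
of every torus Gaussian statement of the tree): `λ₀ = Δ⁻¹Rx`. [cite: Balaban1984PropagatorsI, (1.43)-(1.44) p.25] -/
theorem lambda0_eq_DiT_Rop {c : ℝ} (hc : c ≠ 0) {a : ℝ} {g : L2T n M →ₗ[ℝ] L2T n M} {c₂ : L2B M →ₗ[ℝ] L2B M}
    (hG : GreenData (DeltaT n M c) (QT n M) (QsT n M) a g c₂) (x : L2T n M) :
    lambda0 (QT n M) (QsT n M) g c₂ x = DiT n M c (Rop (NQ n M) (DeltaT n M c) x) := by
  rw [lambda0_eq_lapInv_R144 (lapData_torus n M hc) ⟨QT_adj n M, QT_oneT n M, QT_perp n M⟩ (oneT_ne_zero n M) (oneB_ne_zero M) hG x,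
    Rop_torus_eq_R144_of_greenData n M hG x]

/-- **Hypothesis-free reading of r02's (1.26):** for `c ≠ 0` and every real field `x`, `B5Value126.lambda0 x` is `Δ⁻¹`
applied to the orthogonal projection of `x` onto `ΔN(Q′_k)` — the content of «the infimum in (1.24) is acquired at the
function λ₀» (minimising `‖∂*A − Δλ‖` over `N(Q′_k)` projects `∂*A` onto `ΔN(Q′_k)`). [cite: Balaban1984PropagatorsI, (1.26) p.22 + p.25 ll.2-5] -/
theorem lambda0_eq_LapSinv_Rop {c : ℝ} (hc : c ≠ 0) (x : L2T n M) :
    B5Value126.lambda0 n M (c : ℂ) (cplx (WithLp.ofLp x)) =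
      LapSinv (fine n M) (c : ℂ) *ᵥ cplx (WithLp.ofLp (Rop (NQ n M) (DeltaT n M c) x)) := by
  obtain ⟨_, g, c₂, _, -, -, hG, -, -, -⟩ := exists_all_torus n M hc one_pos
  rw [← cplx_lambda0_eq n M hc hG x, lambda0_eq_DiT_Rop n M hc hG x, cplx_ofLp_DiT]

/-- … so r02's λ₀ solves `Δλ₀ = Rx` for the orthogonal projection R onto `ΔN(Q′_k)`, for EVERY real `x` (r02's
`QsOp_lambda0` gives `Q′_kλ₀ = 0` for every argument, and `residual_lambda0` gives `x − Δλ₀ = PcT x` for `x ⊥ 1`, i.e. this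
sentence with R written as `1 − PcT` on `1^⊥`). [cite: Balaban1984PropagatorsI, (1.25)-(1.26) p.22] -/
theorem LapS_lambda0_eq_Rop {c : ℝ} (hc : c ≠ 0) (x : L2T n M) :
    LapS (fine n M) (c : ℂ) *ᵥ B5Value126.lambda0 n M (c : ℂ) (cplx (WithLp.ofLp x)) =
      cplx (WithLp.ofLp (Rop (NQ n M) (DeltaT n M c) x)) := by
  obtain ⟨_, g, c₂, _, -, -, hG, -, -, -⟩ := exists_all_torus n M hc one_pos
  rw [← cplx_lambda0_eq n M hc hG x, ← cplx_ofLp_DeltaT, lap_lambda0 hG, Rop_torus_eq_R144_of_greenData n M hG x]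

end Torus

end Literature.MathematicalPhysics.QuantumFieldTheory.Balaban1983to89.B5Lambda0TwinBridge

end
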